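/-
Origin: expansion seat `planner-pub-hodgecm-pv11-g5-0`, handover #4 v2 2026-08-18T08:53:07Z doc-only (`HOME/pub-hodgecm-pv11-g5/lean/Pv11g5/SeesawChars.lean`, md5 507293ab, 405 lines);
landed by the gen-7 packager in gate run 27 REPLACES the earlier landed copy of `HodgeCM/PerL34/SeesawChars.lean` (import ^import Pv[0-9]+g[0-9]+\.→import HodgeCM.PerL34. ×1).
-/
/-
Copyright: pub-hodgecm cell, unit pub-hodgecm-pv11-g5 (DAG-NODE PROVER #11, gen 5). Mathlib + tree + own nodes only.
Origin / target: `HOME/pub-hodgecm-pv11-g5/lean/Pv11g5/SeesawChars.lean` → `HodgeCM/PerL34/SeesawChars.lean`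
(packager rewrites the single `import Pv11g5.UnitaryLineChars` to `import HodgeCM.PerL34.UnitaryLineChars`).
-/
import Summits.HodgeConjecture.HodgeCM.PerL34.UnitaryLineChars
import Summits.HodgeConjecture.HodgeCM.PerL34.ArchA

/-!
# The characters of the seesaw torus `[T] = [U(W₁)] × [U(W₂)]` of prescribed archimedean type (genuine idelic model)

Source under adjudication (NOT cited; this file PROVES what it uses): PerL (`PerL-v5-FULL-d912a121.tex`).

* l. 316 (verbatim fragment): "put $\chi_{12}:=\chi'_1\boxtimes\chi'_2$, $\chi_{34}:=\chi'_3\boxtimes\chi'_4$";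
* Lemma 4.2 `lem:chars` (a), ll. 528–529 (verbatim; l. 529 continues with part (b)):

> \textup{(a)} For every $e=(e_b)_b\in\Z^{\{b\}}$ there is an automorphic character $\chi'$ of $[\U(1)]=\U(1)(L_0)\backslash\A^1_L$
> with $\chi'_b(u)=u^{e_b}$ at every real place.

## What is proved (kernel; nothing cited, nothing posited)

For the CM field `L` (`L⁺ = maximalRealSubfield L`), the genuine compact abelian group
`K := SeesawTorus L⁺ L ⧸ SeesawTorus.rat L⁺ L = [T]` (node 1, `SeesawTorus.lean`), its archimedean torus
`Tc := SeesawArchTorus L` with class map `cl := SeesawArchTorus.toQuot L : Tc →* K` and the typed weight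
`w := SeesawArchTorus.weight L m₁ m₂ : Tc →* ℂ`:

1. `NumberField.archWeight_injective` — **the archimedean type is unique**: `archWeight L m = archWeight L m' → m = m'`
   (a character `z ↦ z^k`, `k ≠ 0`, of the circle is non-trivial: `Circle.zpow_eq_one_forall_iff`, from pv02's tree
   lemma `HodgeCM.PerL34.ArchA.exists_zpow_ne_one` (run 19) used by name; and
   `archPlaceChars L : U(1)(L⁺ ⊗ ℝ) → ∏_w S¹` is onto, pv11-g4 `archPlaceChars_surjective`); hence
   `SeesawTorus.HasArchType.unique`.  The one-place subtori `archCoord L w : S¹ →* U(1)(L⁺ ⊗ ℝ)` give the literal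
   per-place reading of l. 529 "with $\chi'_b(u)=u^{e_b}$ at every real place": `SeesawTorus.hasArchType_iff_forall_place :
   HasArchType L χ m ↔ ∀ w z, χ (cl_j (archCoord L w z)) = z ^ (m w)`, and, through Mathlib's
   `IsCMField.equivInfinitePlace L : InfinitePlace L ≃ InfinitePlace L⁺` (real places `b` of `L₀ = L⁺` ↔ places `w` of `L`),
   Lemma 4.2(a) with types indexed by the REAL PLACES OF `L₀` exactly as printed: `SeesawTorus.exists_char_forall_realPlace
   (e : InfinitePlace L⁺ → ℤ) : ∃ χ′, ∀ b u, χ′ (cl_j (archCoord L (b↑) u)) = u ^ (e b)` (+ `forall_realPlace_iff_hasArchType`).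
2. `SeesawTorus.allowedChars L m₁ m₂ := {ξ : PontryaginDual K | χ′₁ := ξ|_{[U(W₁)]} has type m₁ ∧ χ′₂ := ξ|_{[U(W₂)]} has type m₂}` — the INDEX SET `X` of ll. 398–400 ("every character $\chi$ of $[T]$ with $\chi_\infty=w$"); CAUTION: "allowed" in the names below means OF ARCHIMEDEAN TYPE `(m₁,m₂)`, it is NOT PerL Def. 3.2 allowedness (that is the separate predicate `TorusCarrier.allowed : X → Prop` of `HodgeCM.Automorphic.ThetaCarrier`, and Prop. 3.6's hypothesis stays the open input `Open_chars` of `HodgeCM.Automorphic.ThetaFacts`) —,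
   `mem_allowedChars_iff : ξ ∈ allowedChars L m₁ m₂ ↔ (toComplexChar ξ).comp cl = w` (node 1 `weight_comp_archToQuot_iff`;
   `toComplexChar ξ = dualChar ξ` of `AnnihilationModel` is `rfl`), the inclusion `allowedEmb := Subtype.val` and
   **`allowedEmb_surj : ∀ ξ, (toComplexChar ξ).comp cl = w → ∃ χ, allowedEmb χ = ξ`** — the shape of the fields
   `emb` / `emb_surj` of pv06-g3's `CompactTorusDatum` (Prop. 3.6 Step 2, l. 424 "all $\chi$ with $\chi_\infty=w$") for THIS `K, cl, w`.
3. **Non-vacuity = Lemma 4.2(a) for the seesaw torus**: `SeesawTorus.exists_char_hasArchType` /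
   `SeesawTorus.allowedChars_nonempty` — for EVERY pair of types `(m₁, m₂)` there is a character `ξ = χ′₁ ⊠ χ′₂` of `[T]`
   with `ξ_∞ = w(m₁,m₂)` (node 3 `NumberField.exists_pontryaginDual_hasArchType` twice + node 1 `charPair`).
4. Bookkeeping: the type sets `allowedChars L m m'` of different types are disjoint, multiply (`m + m'`), are stable under inversion (`-m`;
   PerL's `P_{T, χ̄}`, l. 425, uses `χ̄ = χ⁻¹`), and contain `1` exactly in type `0`.
-/

set_option autoImplicit false

noncomputable section

open Topology Set Function

/-! ## §0 A character `z ↦ z^k` of the circle is trivial only for `k = 0` -/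

namespace Circle

/-- `(∀ z : S¹, z ^ k = 1) ↔ k = 0` — from the tree lemma `HodgeCM.PerL34.ArchA.exists_zpow_ne_one` (pv02, run 19:
for `k ≠ 0` some `u : S¹` has `(u : ℂ) ^ k ≠ 1`), used BY NAME. -/
theorem zpow_eq_one_forall_iff (k : ℤ) : (∀ z : Circle, z ^ k = 1) ↔ k = 0 := by
  refine ⟨fun h => ?_, fun h z => by rw [h, zpow_zero]⟩
  by_contra hk
  obtain ⟨u, hu⟩ := HodgeCM.PerL34.ArchA.exists_zpow_ne_one hk
  exact hu (by rw [← Circle.coe_zpow, h u, Circle.coe_one])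

end Circle

namespace NumberField

open IsDedekindDomain
open Literature.NumberTheory Literature.NumberTheory.Automorphic

/-! ## §1 Uniqueness of the archimedean type -/

section ArchType

variable (L : Type) [Field L] [NumberField L] [IsCMField L]

open scoped Classical in
/-- On a "coordinate" element `t` with `ι_{w₀}(t_{w₀}) = z` and `ι_w(t_w) = 1` for `w ≠ w₀`, the weight of type `m` is
`z ^ (m w₀)`. -/
theorem archWeightCircle_apply_of_archPlaceChars_eq_mulSingle (m : InfinitePlace L → ℤ) (w₀ : InfinitePlace L) (z : Circle)
    (t : unitaryLineArchTorus L) (ht : archPlaceChars L t = Pi.mulSingle (M := fun _ => Circle) w₀ z) :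
    archWeightCircle L m t = z ^ (m w₀) := by
  change (∏ w, (archPlaceChars L t w) ^ (m w)) = z ^ (m w₀)
  rw [ht, Finset.prod_eq_single w₀]
  · rw [Pi.mulSingle_eq_same]
  · intro w _ hw
    rw [Pi.mulSingle_eq_of_ne hw, one_zpow]
  · intro h
    exact absurd (Finset.mem_univ w₀) h

variable {L}

/-- **The archimedean type of a unitary weight is unique** (circle-valued form). -/
theorem archWeightCircle_injective : Function.Injective (archWeightCircle L) := by
  classical
  intro m m' h
  funext w₀
  have key : ∀ z : Circle, z ^ (m w₀ - m' w₀) = 1 := by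
    intro z
    obtain ⟨t, ht⟩ := archPlaceChars_surjective L (Pi.mulSingle (M := fun _ => Circle) w₀ z)
    have h1 := archWeightCircle_apply_of_archPlaceChars_eq_mulSingle L m w₀ z t ht
    have h2 := archWeightCircle_apply_of_archPlaceChars_eq_mulSingle L m' w₀ z t ht
    rw [h] at h1
    rw [zpow_sub, h1.symm.trans h2, mul_inv_cancel]
  exact sub_eq_zero.mp ((Circle.zpow_eq_one_forall_iff _).mp key)

/-- **The archimedean type of a unitary weight is unique**: `archWeight L m = archWeight L m' → m = m'`. -/
theorem archWeight_injective : Function.Injective (archWeight L) := by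
  intro m m' h
  refine archWeightCircle_injective (MonoidHom.ext fun t => Subtype.val_injective ?_)
  have := DFunLike.congr_fun h t
  rwa [archWeight_apply, archWeight_apply] at this

/-- (Ported verbatim from the HodgeCMPerL package; no docstring in the source.) -/
theorem archWeight_neg (m : InfinitePlace L → ℤ) (t : unitaryLineArchTorus L) :
    archWeight L (-m) t = (archWeight L m t)⁻¹ := by
  have h := archWeight_add L m (-m) t
  rw [add_neg_cancel, archWeight_zero] at h
  have h0 : archWeight L m t ≠ 0 := fun h0 => by simpa [h0] using norm_archWeight L m t
  exact (eq_inv_of_mul_eq_one_right h.symm)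

variable (L)

open scoped Classical in
/-- **The one-place subtorus**: `archCoord L w : S¹ →* U(1)(L⁺ ⊗ ℝ)`, the element with `ι_w`-coordinate `z` and all other
coordinates `1` (through pv11-g4's `unitaryLineArchTorusEquiv L : U(1)(L⁺ ⊗ ℝ) ≃* ∏_w S¹`). -/
def archCoord (w : InfinitePlace L) : Circle →* unitaryLineArchTorus L :=
  (unitaryLineArchTorusEquiv L).symm.toMonoidHom.comp (MonoidHom.mulSingle (fun _ : InfinitePlace L => Circle) w)

open scoped Classical in
/-- (Ported verbatim from the HodgeCMPerL package; no docstring in the source.) -/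
theorem archPlaceChars_archCoord (w : InfinitePlace L) (z : Circle) :
    archPlaceChars L (archCoord L w z) = Pi.mulSingle (M := fun _ => Circle) w z := by
  change unitaryLineArchTorusEquiv L ((unitaryLineArchTorusEquiv L).symm (Pi.mulSingle (M := fun _ => Circle) w z)) = _
  exact MulEquiv.apply_symm_apply _ _

/-- The weight of type `m` on the one-place subtorus at `w` is `z ↦ z ^ (m w)`. -/
theorem archWeightCircle_archCoord (m : InfinitePlace L → ℤ) (w : InfinitePlace L) (z : Circle) :
    archWeightCircle L m (archCoord L w z) = z ^ (m w) :=
  archWeightCircle_apply_of_archPlaceChars_eq_mulSingle L m w z _ (archPlaceChars_archCoord L w z)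

/-- (Ported verbatim from the HodgeCMPerL package; no docstring in the source.) -/
theorem archWeight_archCoord (m : InfinitePlace L → ℤ) (w : InfinitePlace L) (z : Circle) :
    archWeight L m (archCoord L w z) = ((z ^ (m w) : Circle) : ℂ) := by
  rw [archWeight_apply, archWeightCircle_archCoord]

open scoped Classical in
/-- Every element of `U(1)(L⁺ ⊗ ℝ)` is the (finite) product of its one-place components. -/
theorem eq_prod_archCoord (t : unitaryLineArchTorus L) : t = ∏ w, archCoord L w (archPlaceChars L t w) := by
  apply (unitaryLineArchTorusEquiv L).injective
  rw [map_prod]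
  simp only [unitaryLineArchTorusEquiv_apply, archPlaceChars_archCoord]
  exact (Finset.univ_prod_mulSingle _).symm

/-- Two homomorphisms out of `U(1)(L⁺ ⊗ ℝ)` into a commutative monoid agree iff they agree on every one-place subtorus. -/
theorem monoidHom_ext_archCoord {M : Type} [CommMonoid M] {f g : unitaryLineArchTorus L →* M}
    (h : ∀ (w : InfinitePlace L) (z : Circle), f (archCoord L w z) = g (archCoord L w z)) : f = g := by
  refine MonoidHom.ext fun t => ?_
  rw [eq_prod_archCoord L t, map_prod, map_prod]
  exact Finset.prod_congr rfl fun w _ => h w _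

end ArchType

namespace SeesawTorus

section Types

variable {L : Type} [Field L] [NumberField L] [IsCMField L]

local notation "L⁺" => maximalRealSubfield L

/-- **A character of `[U(W_j)]` has at most one archimedean type.** -/
theorem HasArchType.unique {χ : PontryaginDual (relNormOneIdeles L⁺ L ⧸ relNormOneRat L⁺ L)}
    {m m' : InfinitePlace L → ℤ} (h : HasArchType L χ m) (h' : HasArchType L χ m') : m = m' :=
  archWeight_injective (h.archWeight_eq h')

/-- If `χ` has type `m` then `χ⁻¹ = χ̄` has type `-m`. -/
theorem HasArchType.inv {χ : PontryaginDual (relNormOneIdeles L⁺ L ⧸ relNormOneRat L⁺ L)}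
    {m : InfinitePlace L → ℤ} (h : HasArchType L χ m) : HasArchType L χ⁻¹ (-m) := by
  rw [hasArchType_iff] at h ⊢
  intro t
  rw [archWeight_neg, ← h t, ← Circle.coe_inv]
  rfl

/-- **"$\chi'_b(u)=u^{e_b}$ at every real place" (l. 529), literally**: `χ` has archimedean type `m` iff on each one-place
subtorus `U(1) ⊂ U(1)(L⁺ ⊗ ℝ)` at the infinite place `w` of `L` (= the real place `b` of `L⁺ = L₀` below it) the character
`χ ∘ cl_j` is `z ↦ z ^ (m w)`. -/
theorem hasArchType_iff_forall_place (χ : PontryaginDual (relNormOneIdeles L⁺ L ⧸ relNormOneRat L⁺ L))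
    (m : InfinitePlace L → ℤ) :
    HasArchType L χ m ↔ ∀ (w : InfinitePlace L) (z : Circle), χ (unitaryLineArchToQuot L (archCoord L w z)) = z ^ (m w) := by
  rw [hasArchType_iff]
  constructor
  · intro h w z
    apply Subtype.val_injective
    have := h (archCoord L w z)
    rwa [archWeight_archCoord] at this
  · intro h
    have key : (χ : (relNormOneIdeles L⁺ L ⧸ relNormOneRat L⁺ L) →* Circle).comp (unitaryLineArchToQuot L) =
        archWeightCircle L m :=
      monoidHom_ext_archCoord L fun w z => by
        rw [MonoidHom.comp_apply, archWeightCircle_archCoord]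
        exact h w z
    intro t
    have := DFunLike.congr_fun key t
    rw [MonoidHom.comp_apply] at this
    rw [archWeight_apply, ← this]
    rfl

/-- **Lemma 4.2(a) in its literal form, types indexed by the real places `b` of `L₀ = L⁺`** (ll. 528–529: "For every
$e=(e_b)_b\in\Z^{\{b\}}$ there is an automorphic character $\chi'$ of $[\U(1)]=\U(1)(L_0)\backslash\A^1_L$ with
$\chi'_b(u)=u^{e_b}$ at every real place"): the real places `b` of `L⁺` correspond to the infinite places `w` of the CM
field `L` by Mathlib's `NumberField.IsCMField.equivInfinitePlace L : InfinitePlace L ≃ InfinitePlace L⁺` (`w ↦ w|_{L⁺}`), and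
for every `e : (b) → ℤ` there is an automorphic character `χ′` of `[U(1)]` which on the one-place subtorus at the place
`w` above `b` is `u ↦ u ^ (e b)`. -/
theorem exists_char_forall_realPlace (e : InfinitePlace L⁺ → ℤ) :
    ∃ χ : PontryaginDual (relNormOneIdeles L⁺ L ⧸ relNormOneRat L⁺ L),
      ∀ (b : InfinitePlace L⁺) (u : Circle),
        χ (unitaryLineArchToQuot L (archCoord L ((IsCMField.equivInfinitePlace L).symm b) u)) = u ^ (e b) := by
  obtain ⟨χ, hχ⟩ := NumberField.exists_pontryaginDual_hasArchType L (e ∘ IsCMField.equivInfinitePlace L)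
  refine ⟨χ, fun b u => ?_⟩
  rw [(hasArchType_iff_forall_place χ _).mp hχ, Function.comp_apply, Equiv.apply_symm_apply]

/-- Conversely the per-real-place condition determines the archimedean type: `χ′_b(u) = u^{e_b}` at every real place `b`
iff `χ′` has archimedean type `e ∘ (w ↦ w|_{L⁺})`. -/
theorem forall_realPlace_iff_hasArchType (χ : PontryaginDual (relNormOneIdeles L⁺ L ⧸ relNormOneRat L⁺ L))
    (e : InfinitePlace L⁺ → ℤ) :
    (∀ (b : InfinitePlace L⁺) (u : Circle),
        χ (unitaryLineArchToQuot L (archCoord L ((IsCMField.equivInfinitePlace L).symm b) u)) = u ^ (e b)) ↔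
      HasArchType L χ (e ∘ IsCMField.equivInfinitePlace L) := by
  rw [hasArchType_iff_forall_place]
  constructor
  · intro h w z
    have := h (IsCMField.equivInfinitePlace L w) z
    rwa [Equiv.symm_apply_apply] at this
  · intro h b u
    rw [h, Function.comp_apply, Equiv.apply_symm_apply]

/-- **Every archimedean type is realised** (node 3, restated in the `SeesawTorus` namespace for convenience):
for every `m` there is an automorphic character of `[U(W_j)]` of type `m` — PerL Lemma 4.2(a). -/
theorem exists_hasArchType (m : InfinitePlace L → ℤ) :
    ∃ χ : PontryaginDual (relNormOneIdeles L⁺ L ⧸ relNormOneRat L⁺ L), HasArchType L χ m :=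
  NumberField.exists_pontryaginDual_hasArchType L m

end Types

/-! ## §2 The characters of `[T]` of archimedean type `(m₁, m₂)` ("allowed" in the names = of type `(m₁,m₂)`; NOT Def. 3.2 allowedness) -/

section Allowed

variable (L : Type) [Field L] [NumberField L] [IsCMField L]

local notation "L⁺" => maximalRealSubfield L

/-- **The characters of `[T]` of archimedean type `(m₁, m₂)`** — the index set `X` of ll. 398–400; the name `allowedChars` does NOT refer to PerL Def. 3.2 allowedness (which is `TorusCarrier.allowed : X → Prop`, an open input): the characters `ξ = χ′₁ ⊠ χ′₂` of
`[T] = [U(W₁)] × [U(W₂)]` whose components `χ′_j := ξ|_{[U(W_j)]}` have the archimedean types `m_j`. -/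
def allowedChars (m₁ m₂ : InfinitePlace L → ℤ) : Set (PontryaginDual (SeesawTorus L⁺ L ⧸ rat L⁺ L)) :=
  {ξ | HasArchType L (charFst ξ) m₁ ∧ HasArchType L (charSnd ξ) m₂}

variable {L}

/-- (Ported verbatim from the HodgeCMPerL package; no docstring in the source.) -/
theorem mem_allowedChars (m₁ m₂ : InfinitePlace L → ℤ) (ξ : PontryaginDual (SeesawTorus L⁺ L ⧸ rat L⁺ L)) :
    ξ ∈ allowedChars L m₁ m₂ ↔ HasArchType L (charFst ξ) m₁ ∧ HasArchType L (charSnd ξ) m₂ := Iff.rfl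

/-- **`ξ ∈ allowedChars L m₁ m₂` (i.e. `ξ` has type `(m₁,m₂)`) iff `ξ_∞ = w(m₁,m₂)`**, i.e. iff `(toComplexChar ξ).comp cl = w` with
`cl = SeesawArchTorus.toQuot L`, `w = SeesawArchTorus.weight L m₁ m₂` — the hypothesis of `CompactTorusDatum.emb_surj`
(`toComplexChar ξ = dualChar ξ` by `rfl`). -/
theorem mem_allowedChars_iff (m₁ m₂ : InfinitePlace L → ℤ) (ξ : PontryaginDual (SeesawTorus L⁺ L ⧸ rat L⁺ L)) :
    ξ ∈ allowedChars L m₁ m₂ ↔ (toComplexChar ξ).comp (SeesawArchTorus.toQuot L) = SeesawArchTorus.weight L m₁ m₂ :=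
  (weight_comp_archToQuot_iff ξ m₁ m₂).symm

/-- (Ported verbatim from the HodgeCMPerL package; no docstring in the source.) -/
theorem charPair_mem_allowedChars_iff (m₁ m₂ : InfinitePlace L → ℤ)
    (ξ₁ ξ₂ : PontryaginDual (relNormOneIdeles L⁺ L ⧸ relNormOneRat L⁺ L)) :
    charPair ξ₁ ξ₂ ∈ allowedChars L m₁ m₂ ↔ HasArchType L ξ₁ m₁ ∧ HasArchType L ξ₂ m₂ := by
  rw [mem_allowedChars, charFst_charPair, charSnd_charPair]

variable (L)

/-- The inclusion of the characters of type `(m₁,m₂)` (the index set `X`) into all characters of `[T]` (the field `emb`). -/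
def allowedEmb (m₁ m₂ : InfinitePlace L → ℤ) : allowedChars L m₁ m₂ → PontryaginDual (SeesawTorus L⁺ L ⧸ rat L⁺ L) :=
  Subtype.val

variable {L}

/-- (Ported verbatim from the HodgeCMPerL package; no docstring in the source.) -/
@[simp] theorem allowedEmb_apply (m₁ m₂ : InfinitePlace L → ℤ) (χ : allowedChars L m₁ m₂) : allowedEmb L m₁ m₂ χ = χ := rfl

/-- (Ported verbatim from the HodgeCMPerL package; no docstring in the source.) -/
theorem allowedEmb_injective (m₁ m₂ : InfinitePlace L → ℤ) : Function.Injective (allowedEmb L m₁ m₂) :=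
  Subtype.val_injective

/-- Every character in `allowedChars L m₁ m₂` has `ξ_∞ = w`. -/
theorem toComplexChar_allowedEmb_comp_toQuot (m₁ m₂ : InfinitePlace L → ℤ) (χ : allowedChars L m₁ m₂) :
    (toComplexChar (allowedEmb L m₁ m₂ χ)).comp (SeesawArchTorus.toQuot L) = SeesawArchTorus.weight L m₁ m₂ :=
  (mem_allowedChars_iff m₁ m₂ _).mp χ.2

/-- **`emb_surj` for the genuine seesaw torus** (Prop. 3.6 Step 2 quantifies over "all $\chi$ with $\chi_\infty=w$",
l. 424): every character `ξ` of `[T]` with `ξ_∞ = w(m₁,m₂)` lies in the index set `allowedChars L m₁ m₂` (ll. 398–400) — `X` EXHAUSTS the type-`w` characters; this says nothing about Def. 3.2 allowedness. -/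
theorem allowedEmb_surj (m₁ m₂ : InfinitePlace L → ℤ) :
    ∀ ξ : PontryaginDual (SeesawTorus L⁺ L ⧸ rat L⁺ L),
      (toComplexChar ξ).comp (SeesawArchTorus.toQuot L) = SeesawArchTorus.weight L m₁ m₂ →
        ∃ χ : allowedChars L m₁ m₂, allowedEmb L m₁ m₂ χ = ξ :=
  fun ξ hξ => ⟨⟨ξ, (mem_allowedChars_iff m₁ m₂ ξ).mpr hξ⟩, rfl⟩

/-- The same with the class map written as `(QuotientGroup.mk' Λ).comp ιc`, `Λ = SeesawTorus.rat`, `ιc = SeesawArchTorus.toAdeles`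
(the literal shape of the field `emb_surj` of pv15-g2's `CompactInput`; `SeesawArchTorus.toQuot L = mk' ∘ toAdeles` is `rfl`). -/
theorem allowedEmb_surj' (m₁ m₂ : InfinitePlace L → ℤ) :
    ∀ ξ : PontryaginDual (SeesawTorus L⁺ L ⧸ rat L⁺ L),
      (toComplexChar ξ).comp ((QuotientGroup.mk' (rat L⁺ L)).comp (SeesawArchTorus.toAdeles L)) =
          SeesawArchTorus.weight L m₁ m₂ →
        ∃ χ : allowedChars L m₁ m₂, allowedEmb L m₁ m₂ χ = ξ :=
  allowedEmb_surj m₁ m₂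

/-- (Ported verbatim from the HodgeCMPerL package; no docstring in the source.) -/
theorem range_allowedEmb (m₁ m₂ : InfinitePlace L → ℤ) :
    Set.range (allowedEmb L m₁ m₂) =
      {ξ | (toComplexChar ξ).comp (SeesawArchTorus.toQuot L) = SeesawArchTorus.weight L m₁ m₂} := by
  ext ξ
  constructor
  · rintro ⟨χ, rfl⟩
    exact toComplexChar_allowedEmb_comp_toQuot m₁ m₂ χ
  · intro hξ
    obtain ⟨χ, hχ⟩ := allowedEmb_surj m₁ m₂ ξ hξ
    exact ⟨χ, hχ⟩

/-! ### Non-vacuity: PerL Lemma 4.2(a) for the seesaw torus -/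

/-- **For every pair of types there is a character `ξ = χ′₁ ⊠ χ′₂` of `[T]` of that type** (node 3 = Lemma 4.2(a) on each
factor `[U(W_j)]`, paired by node 1's `charPair`). -/
theorem exists_char_hasArchType (m₁ m₂ : InfinitePlace L → ℤ) :
    ∃ ξ : PontryaginDual (SeesawTorus L⁺ L ⧸ rat L⁺ L), HasArchType L (charFst ξ) m₁ ∧ HasArchType L (charSnd ξ) m₂ := by
  obtain ⟨χ₁, h₁⟩ := NumberField.exists_pontryaginDual_hasArchType L m₁
  obtain ⟨χ₂, h₂⟩ := NumberField.exists_pontryaginDual_hasArchType L m₂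
  exact ⟨charPair χ₁ χ₂, (charPair_mem_allowedChars_iff m₁ m₂ χ₁ χ₂).mpr ⟨h₁, h₂⟩⟩

/-- The same, in the `ξ_∞ = w` form: **for every typed weight `w(m₁,m₂)` there is a character `ξ` of `[T]` with
`(toComplexChar ξ).comp cl = w`.** -/
theorem exists_char_comp_toQuot_eq_weight (m₁ m₂ : InfinitePlace L → ℤ) :
    ∃ ξ : PontryaginDual (SeesawTorus L⁺ L ⧸ rat L⁺ L),
      (toComplexChar ξ).comp (SeesawArchTorus.toQuot L) = SeesawArchTorus.weight L m₁ m₂ := by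
  obtain ⟨ξ, hξ⟩ := exists_char_hasArchType m₁ m₂
  exact ⟨ξ, (mem_allowedChars_iff m₁ m₂ ξ).mp hξ⟩

/-- (Ported verbatim from the HodgeCMPerL package; no docstring in the source.) -/
theorem allowedChars_nonempty (m₁ m₂ : InfinitePlace L → ℤ) : (allowedChars L m₁ m₂).Nonempty :=
  exists_char_hasArchType m₁ m₂

/-- (Ported verbatim from the HodgeCMPerL package; no docstring in the source.) -/
instance nonempty_allowedChars (m₁ m₂ : InfinitePlace L → ℤ) : Nonempty (allowedChars L m₁ m₂) :=
  (allowedChars_nonempty m₁ m₂).to_subtype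

/-! ### Bookkeeping: types are unique, add under products, negate under inversion -/

/-- A character of `[T]` has at most one archimedean type. -/
theorem eq_of_mem_allowedChars {m₁ m₂ m₁' m₂' : InfinitePlace L → ℤ} {ξ : PontryaginDual (SeesawTorus L⁺ L ⧸ rat L⁺ L)}
    (h : ξ ∈ allowedChars L m₁ m₂) (h' : ξ ∈ allowedChars L m₁' m₂') : m₁ = m₁' ∧ m₂ = m₂' :=
  ⟨h.1.unique h'.1, h.2.unique h'.2⟩

/-- (Ported verbatim from the HodgeCMPerL package; no docstring in the source.) -/
theorem disjoint_allowedChars {m₁ m₂ m₁' m₂' : InfinitePlace L → ℤ} (h : (m₁, m₂) ≠ (m₁', m₂')) :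
    Disjoint (allowedChars L m₁ m₂) (allowedChars L m₁' m₂') := by
  rw [Set.disjoint_left]
  intro ξ hξ hξ'
  obtain ⟨rfl, rfl⟩ := eq_of_mem_allowedChars hξ hξ'
  exact h rfl

/-- (Ported verbatim from the HodgeCMPerL package; no docstring in the source.) -/
theorem mul_mem_allowedChars {m₁ m₂ m₁' m₂' : InfinitePlace L → ℤ} {ξ η : PontryaginDual (SeesawTorus L⁺ L ⧸ rat L⁺ L)}
    (h : ξ ∈ allowedChars L m₁ m₂) (h' : η ∈ allowedChars L m₁' m₂') : ξ * η ∈ allowedChars L (m₁ + m₁') (m₂ + m₂') := by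
  refine ⟨?_, ?_⟩
  · rw [charFst_mul]; exact h.1.mul h'.1
  · rw [charSnd_mul]; exact h.2.mul h'.2

/-- (Ported verbatim from the HodgeCMPerL package; no docstring in the source.) -/
theorem one_mem_allowedChars_zero : (1 : PontryaginDual (SeesawTorus L⁺ L ⧸ rat L⁺ L)) ∈ allowedChars L 0 0 :=
  ⟨hasArchType_one, hasArchType_one⟩

omit [IsCMField L] in
/-- (Ported verbatim from the HodgeCMPerL package; no docstring in the source.) -/
theorem charFst_inv (ξ : PontryaginDual (SeesawTorus L⁺ L ⧸ rat L⁺ L)) : charFst ξ⁻¹ = (charFst ξ)⁻¹ := rfl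

omit [IsCMField L] in
/-- (Ported verbatim from the HodgeCMPerL package; no docstring in the source.) -/
theorem charSnd_inv (ξ : PontryaginDual (SeesawTorus L⁺ L ⧸ rat L⁺ L)) : charSnd ξ⁻¹ = (charSnd ξ)⁻¹ := rfl


-- port_pkg: scope closed for this part
end Allowed
end SeesawTorus
end NumberField
end
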